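import Summits.ResolutionOfSingularities.ResolutionOfSingularities.Theorems.PurelyInseparableDim4ResConeTiltedTail
import Summits.ResolutionOfSingularities.ResolutionOfSingularities.Theorems.PurelyInseparableDim4Equimultiple
import HarnessLib
import HarnessLib.Audit.Tags

/-!
# Purely inseparable four-folds — THE ABSTRACT VIRTUAL CHAIN of the D∞ `(5,4)` re-presentation: from ANY step-invariant
# producing pair charts, a witnessed pair-confined passive-free chain, killed by `no_pair_tail_four_five`
# (K2(p) lane, SLICE C, hN4-D «D∞ pair-confinement re-presentation», invariant-agnostic assembly F5⁰; file-holder res-dim4-p-5 g5)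

[OURS · counted 0 · cell `res-dim4-pi` · K2(p) lane, slice C (res-dim4-typ-1 g4's hN4-D design of record, bus 2026-08-29 07:44:53Z,
files F1–F5; this is the invariant-agnostic half of F5, offered 07:51Z) · seat p-5 g5.]  Nothing here proves hN4-D, TAIL-D, K2(p)/K2(5),
`NoIsolatedTrap p p` or resolution of singularities in dimension ≥ 4 / char. `p` — NOT proved; every theorem is CONDITIONAL on an
abstract one-step hypothesis `hvstep`.  AI kernel work, weaker than expert review.

The hN4-D route (socket `ResCone.no_dInf_tail_of_representation`, p703603) re-presents a D∞ tail as a chain whose chart letters lie in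
a fixed pair `{a, a′}` and whose other two letters are never boundary letters, and then applies res-dim4-p-5 g4's
`ResCone.no_pair_tail_four_five`.  The re-presentation is built FORWARD by `Nat.rec` + `Classical.epsilon` from a one-step lemma
(res-dim4-typ-1 g4's F4 `…DInfVirtualStep`), exactly as res-dim4-p-3 g4 built the light-pair chain (`…LightPairRepresentation`).
This file does the assembly ONCE for an ARBITRARY invariant `Inv : ℕ → State K → Prop` (virtual time, virtual state):
* **`dInf_virtual_chain`** — from `Inv 0 B₀`, a SHAPE clause (`Inv t B` ⇒ `B` isolated, `ord₀ B.F = |B.r| + 4`, `2 ≤ |B.r|`,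
  `e_G(B) = 2`, `B.r` supported on `{a, a′}`, `x^{B.r} ∣ B.F`) and a STEP clause (`Inv t B` ⇒ some chart `ℓ ∈ {a, a′}` and
  translation `β` with `β ℓ = 0` give `Inv (t+1) (step 5 univ ℓ β B)`), a chain `c′` with `c′ 0 = B₀`, `Inv t (c′ t)` for all `t`,
  which is a WITNESSED isolated above-floor `Step0 5` chain with `x^{r₀} ∣ F₀`, constant shade `4`, `e_G ≡ 2`, chart letters in
  `{a, a′}` and the other letters never boundary;
* **`no_dInf_virtual_chain`** — hence `False` (`no_pair_tail_four_five`);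
* **`dInf_representation_of_virtual_chain`** — the same packaged as the ∃-conclusion of the hN4-D binder.
So F5 = «instantiate `Inv` with the transported-frame invariant, `hentry` at a `dInf_tt` time (res-dim4-p-5 g5, p707227),
`hvstep` := F4».  Nothing about frames, relations, precisions or TT is assumed here.
[cite: CossartJannsenSaito2020, Thm. 3.14] [cite: Hauser2010, §§F–G (chart expressions of a point blowup; cleaning)]
bears_on: LADDER-RESOLUTION:D157-DOOR2 (res-dim4-pi · K2(p) = `RidgeBudget.NoAboveFloorTrap p p` · slice C, TAIL-D `(5,4)` D∞ class, hN4-D).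
Supports stmt-ResolutionOfSingularities-16155 (helper).
-/

set_option linter.dupNamespace false -- mandated namespace of this single-conjunct summit

noncomputable section

namespace Summit.ResolutionOfSingularities.ResolutionOfSingularities.Theorems.PIDim4

namespace ResCone

open MvPolynomial Finset
open Literature.AlgebraicGeometry.Resolution
open Literature.AlgebraicGeometry.Resolution.CentreBlowup
open Literature.AlgebraicGeometry.Resolution.Hauser2010
open Literature.AlgebraicGeometry.Resolution.HauserPerlega2019

variable {K : Type} [Field K] [CharP K 5] [DecidableEq K]

omit [CharP K 5] in
/-- **THE ABSTRACT VIRTUAL CHAIN.**  Let `Inv : ℕ → State K → Prop` be any predicate (virtual time, virtual state) such that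
(SHAPE) every `Inv`-state is isolated, off the floor with `ord₀ F = |r| + 4`, `2 ≤ |r|`, `e_G = 2`, boundary letters in `{a, a′}`,
`x^r ∣ F`; and (STEP) from every `Inv t B` some point step charted in the pair, `ℓ ∈ {a, a′}`, `β ℓ = 0`, leads to
`Inv (t+1) (step 5 univ ℓ β B)`.  Then from any `Inv 0 B₀` there is a chain `c′` with `c′ 0 = B₀`, `Inv t (c′ t)`, which is a
witnessed isolated above-floor `Step0 5` chain with `x^{r₀} ∣ F₀`, constant shade `4`, `e_G ≡ 2`, chart letters in `{a, a′}` and the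
other two letters never boundary. (`Nat.rec` + `Classical.epsilon`, res-dim4-p-3 g4's pattern.) [OURS · conditional on `hvstep`]
[cite: CossartJannsenSaito2020, Thm. 3.14] [cite: Hauser2010, §§F–G (chart expressions of a point blowup; cleaning)] -/
theorem dInf_virtual_chain {Inv : ℕ → State K → Prop} {a a' : Fin 4} {B₀ : State K} (hentry : Inv 0 B₀)
    (hshape : ∀ t B, Inv t B → IsIsolated 5 B.F ∧ ordZero B.F = ((B.r.degree + 4 : ℕ) : ℕ∞) ∧ 2 ≤ B.r.degree ∧
      Module.finrank K (resVertex B) = 2 ∧ (∀ i, i ≠ a → i ≠ a' → B.r i = 0) ∧ (∀ d ∈ B.F.support, B.r ≤ d))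
    (hvstep : ∀ t B, Inv t B → ∃ (ℓ : Fin 4) (β : Fin 4 → K), (ℓ = a ∨ ℓ = a') ∧ β ℓ = 0 ∧
      Inv (t + 1) (CentreBlowup.step 5 Finset.univ ℓ β B)) :
    ∃ (c' : ℕ → State K) (j' : ℕ → Fin 4) (b' : ℕ → Fin 4 → K), c' 0 = B₀ ∧ (∀ t, Inv t (c' t)) ∧
      (∀ t, IsIsolated 5 (c' t).F ∧ Step0 5 (c' t) (c' (t + 1))) ∧ FreeTail.IsWitnessedChain 5 c' j' b' ∧
      (∀ e ∈ (c' 0).F.support, (c' 0).r ≤ e) ∧ (∀ t, ordZero (c' t).F ≠ (5 : ℕ)) ∧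
      (∀ t, 0 ≤ t → (c' t).shade = ((4 : ℕ) : ℕ∞)) ∧ (∀ t, 0 ≤ t → Module.finrank K (resVertex (c' t)) = 2) ∧
      (∀ t, 0 ≤ t → (j' t = a ∨ j' t = a')) ∧ (∀ t, 0 ≤ t → ∀ i, i ≠ a → i ≠ a' → (c' t).r i = 0) := by
  -- (1) the step predicate and the recursion
  obtain ⟨Q, hQ⟩ : ∃ Q : ℕ → State K → Fin 4 × (Fin 4 → K) → Prop,
      ∀ t B x, Q t B x ↔ ((x.1 = a ∨ x.1 = a') ∧ x.2 x.1 = 0 ∧ Inv (t + 1) (CentreBlowup.step 5 Finset.univ x.1 x.2 B)) :=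
    ⟨_, fun _ _ _ => Iff.rfl⟩
  obtain ⟨sq, hd0, hds⟩ : ∃ sq : ℕ → State K, sq 0 = B₀ ∧
      ∀ t, sq (t + 1) = CentreBlowup.step 5 Finset.univ (Classical.epsilon (Q t (sq t))).1
        (Classical.epsilon (Q t (sq t))).2 (sq t) :=
    ⟨fun t => Nat.rec B₀ (fun t dt => CentreBlowup.step 5 Finset.univ (Classical.epsilon (Q t dt)).1
      (Classical.epsilon (Q t dt)).2 dt) t, rfl, fun _ => rfl⟩
  -- (2) the invariant along the recursion
  have hINV : ∀ t, Inv t (sq t) := by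
    intro t
    induction t with
    | zero => rw [hd0]; exact hentry
    | succ t ih =>
      have hex : ∃ x, Q t (sq t) x := by
        obtain ⟨ℓ, β, hℓ, hβ, h⟩ := hvstep t (sq t) ih
        exact ⟨(ℓ, β), (hQ t (sq t) (ℓ, β)).mpr ⟨hℓ, hβ, h⟩⟩
      obtain ⟨-, -, h⟩ := (hQ t (sq t) _).mp (Classical.epsilon_spec hex)
      rw [hds t]
      exact h
  have hspec : ∀ t, Q t (sq t) (Classical.epsilon (Q t (sq t))) := fun t => by
    have hex : ∃ x, Q t (sq t) x := by
      obtain ⟨ℓ, β, hℓ, hβ, h⟩ := hvstep t (sq t) (hINV t)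
      exact ⟨(ℓ, β), (hQ t (sq t) (ℓ, β)).mpr ⟨hℓ, hβ, h⟩⟩
    exact Classical.epsilon_spec hex
  -- (3) the packaging
  have hℓ : ∀ t, (Classical.epsilon (Q t (sq t))).1 = a ∨ (Classical.epsilon (Q t (sq t))).1 = a' := fun t =>
    ((hQ t (sq t) _).mp (hspec t)).1
  have hβℓ : ∀ t, (Classical.epsilon (Q t (sq t))).2 (Classical.epsilon (Q t (sq t))).1 = 0 := fun t =>
    ((hQ t (sq t) _).mp (hspec t)).2.1
  have hisoV : ∀ t, IsIsolated 5 (sq t).F := fun t => (hshape t (sq t) (hINV t)).1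
  have hoV : ∀ t, ordZero (sq t).F = (((sq t).r.degree + 4 : ℕ) : ℕ∞) := fun t => (hshape t (sq t) (hINV t)).2.1
  have h2V : ∀ t, 2 ≤ (sq t).r.degree := fun t => (hshape t (sq t) (hINV t)).2.2.1
  have heV : ∀ t, Module.finrank K (resVertex (sq t)) = 2 := fun t => (hshape t (sq t) (hINV t)).2.2.2.1
  have hpassV : ∀ t, ∀ i, i ≠ a → i ≠ a' → (sq t).r i = 0 := fun t => (hshape t (sq t) (hINV t)).2.2.2.2.1
  have hdivV : ∀ t, ∀ d ∈ (sq t).F.support, (sq t).r ≤ d := fun t => (hshape t (sq t) (hINV t)).2.2.2.2.2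
  have h5le : ∀ t, ((5 : ℕ) : ℕ∞) ≤ ordAlong Finset.univ (sq t).F := fun t => by
    rw [ordAlong_univ, hoV t]
    have := h2V t
    exact_mod_cast (by omega)
  have hequi : ∀ t, IsEquimultiplePoint 5 Finset.univ (Classical.epsilon (Q t (sq t))).1 (Classical.epsilon (Q t (sq t))).2
      (sq t) := fun t => by
    rw [Equimultiple.isEquimultiplePoint_iff_le_ordZero_step, ← hds t, hoV (t + 1)]
    have := h2V (t + 1)
    exact_mod_cast (by omega)
  have hne : ∀ t, (CentreBlowup.step 5 Finset.univ (Classical.epsilon (Q t (sq t))).1 (Classical.epsilon (Q t (sq t))).2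
      (sq t)).F ≠ 0 := fun t h0 => by
    have h := hoV (t + 1)
    rw [hds t, h0, ordZero_zero] at h
    exact ENat.top_ne_coe _ h
  have hfloorV : ∀ t, ordZero (sq t).F ≠ (5 : ℕ) := fun t h => by
    rw [hoV t] at h
    have := h2V t
    have h' : (sq t).r.degree + 4 = 5 := by exact_mod_cast h
    omega
  have hshadeV : ∀ t, (sq t).shade = ((4 : ℕ) : ℕ∞) := fun t => by
    rw [BandShade.shade_eq_coe (hoV t)]
    congr 1
    omega
  refine ⟨sq, fun t => (Classical.epsilon (Q t (sq t))).1, fun t => (Classical.epsilon (Q t (sq t))).2, hd0, hINV,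
    fun t => ⟨hisoV t, h5le t, (Classical.epsilon (Q t (sq t))).1, (Classical.epsilon (Q t (sq t))).2, Finset.mem_univ _,
      hβℓ t, hequi t, hne t, hds t⟩,
    fun t => ⟨h5le t, hβℓ t, hequi t, hne t, hds t⟩, ?_, hfloorV, fun t _ => hshadeV t, fun t _ => heV t,
    fun t _ => hℓ t, fun t _ => hpassV t⟩
  rw [hd0]
  have := hdivV 0
  rwa [hd0] at this

/-- **NO D∞ TAIL THROUGH A VIRTUAL CHAIN**: under the hypotheses of `dInf_virtual_chain` the entry state cannot exist — the virtual
chain is a pair-confined passive-free shade-`4` `e_G = 2` tail, excluded by res-dim4-p-5 g4's `no_pair_tail_four_five`.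
[OURS · conditional on `hvstep`] [cite: CossartJannsenSaito2020, Thm. 3.14] -/
theorem no_dInf_virtual_chain {Inv : ℕ → State K → Prop} {a a' : Fin 4} (haa' : a ≠ a') {B₀ : State K}
    (hentry : Inv 0 B₀)
    (hshape : ∀ t B, Inv t B → IsIsolated 5 B.F ∧ ordZero B.F = ((B.r.degree + 4 : ℕ) : ℕ∞) ∧ 2 ≤ B.r.degree ∧
      Module.finrank K (resVertex B) = 2 ∧ (∀ i, i ≠ a → i ≠ a' → B.r i = 0) ∧ (∀ d ∈ B.F.support, B.r ≤ d))
    (hvstep : ∀ t B, Inv t B → ∃ (ℓ : Fin 4) (β : Fin 4 → K), (ℓ = a ∨ ℓ = a') ∧ β ℓ = 0 ∧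
      Inv (t + 1) (CentreBlowup.step 5 Finset.univ ℓ β B)) : False := by
  haveI : Fact (Nat.Prime 5) := ⟨by norm_num⟩
  obtain ⟨c', j', b', -, -, hc', hw', hr0', hfloor', hshade', he', hletters', hpass'⟩ :=
    dInf_virtual_chain hentry hshape hvstep
  exact no_pair_tail_four_five hc' hw' hr0' (fun t => by exact_mod_cast hfloor' t) (k₀ := 0) hshade' he' haa'
    hletters' hpass'

omit [CharP K 5] in
/-- **THE hN4-D CONCLUSION FROM A VIRTUAL CHAIN**: under the hypotheses of `dInf_virtual_chain` the ∃-conclusion of the hN4-D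
binder of `ResCone.no_dInf_tail_of_representation` holds (with `k₀′ = 0`). [OURS · conditional on `hvstep`]
[cite: CossartJannsenSaito2020, Thm. 3.14] -/
theorem dInf_representation_of_virtual_chain {Inv : ℕ → State K → Prop} {a a' : Fin 4} (haa' : a ≠ a') {B₀ : State K}
    (hentry : Inv 0 B₀)
    (hshape : ∀ t B, Inv t B → IsIsolated 5 B.F ∧ ordZero B.F = ((B.r.degree + 4 : ℕ) : ℕ∞) ∧ 2 ≤ B.r.degree ∧
      Module.finrank K (resVertex B) = 2 ∧ (∀ i, i ≠ a → i ≠ a' → B.r i = 0) ∧ (∀ d ∈ B.F.support, B.r ≤ d))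
    (hvstep : ∀ t B, Inv t B → ∃ (ℓ : Fin 4) (β : Fin 4 → K), (ℓ = a ∨ ℓ = a') ∧ β ℓ = 0 ∧
      Inv (t + 1) (CentreBlowup.step 5 Finset.univ ℓ β B)) :
    ∃ (c' : ℕ → State K) (j' : ℕ → Fin 4) (b' : ℕ → Fin 4 → K) (k₀' : ℕ) (a a' : Fin 4),
      (∀ k, IsIsolated 5 (c' k).F ∧ Step0 5 (c' k) (c' (k + 1))) ∧ FreeTail.IsWitnessedChain 5 c' j' b' ∧
      (∀ e ∈ (c' 0).F.support, (c' 0).r ≤ e) ∧ (∀ k, ordZero (c' k).F ≠ (5 : ℕ)) ∧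
      (∀ k, k₀' ≤ k → (c' k).shade = ((4 : ℕ) : ℕ∞)) ∧
      (∀ k, k₀' ≤ k → Module.finrank K (resVertex (c' k)) = 2) ∧ a ≠ a' ∧
      (∀ k, k₀' ≤ k → (j' k = a ∨ j' k = a')) ∧
      (∀ k, k₀' ≤ k → ∀ i, i ≠ a → i ≠ a' → (c' k).r i = 0) := by
  obtain ⟨c', j', b', -, -, hc', hw', hr0', hfloor', hshade', he', hletters', hpass'⟩ :=
    dInf_virtual_chain hentry hshape hvstep
  exact ⟨c', j', b', 0, a, a', hc', hw', hr0', hfloor', hshade', he', haa', hletters', hpass'⟩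

end ResCone

end Summit.ResolutionOfSingularities.ResolutionOfSingularities.Theorems.PIDim4

end
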